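import Mathlib
import Summits.Ventures.PercRepro2.SwAllHMarkDefs

/-!
# THE MARK WITH NEIGHBOURS `p` AND `h` ONLY, II: the colour swap off the edges at `x`
(blind cell PercRepro2, night-4 g30, 2026-08-28; proofs/NIGHT4-G30.md)

`swapOff ends x ζ` changes the colour of every edge NOT at `x` and keeps the edges at `x`.  In the
isolated graph (where the edges at `x` are loops) it acts as the colour swap: the clusters of
`swapOff ζ` are those of `blue ζ` (`cluster_isolate_swapOff`), the two edge sets of `h` are
exchanged (`redEdges_isolate_swapOff`, `blueEdges_isolate_swapOff`), and it is an involution.  On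
the part `B = {p ∈ C_B(l)}` of the side of the H-mark — where every edge `x–p` is red and every
edge `x–h` is blue — the swap keeps the side and the part (`IsHMarkAt.swapOff_mem`): the
hypotheses of `IsHMarkAt.mem_tgt_iff` are symmetric in the two colours once the bits at `x` are
fixed.  Used for part `B` of the counting in `SwAllHMarkThm`.
-/

namespace Summit.Ventures.PercRepro2

namespace LocRows

open Hull

variable {V : Type*} {E : Type*}

open scoped Classical

/-- The colour swap off the edges at `x`: the edges at `x` keep their colour, every other edge
changes colour. -/
noncomputable def swapOff (ends : E → Sym2 V) (x : V) (ζ : Config E) : Config E :=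
  fun e => if x ∈ ends e then ζ e else !ζ e

variable {ends : E → Sym2 V} {x : V}

/-- The swap keeps the edges at `x`. -/
lemma swapOff_apply_of_mem {ζ : Config E} {e : E} (he : x ∈ ends e) :
    swapOff ends x ζ e = ζ e := by
  simp only [swapOff, if_pos he]

/-- Off the edges at `x` the swap is the colour swap. -/
lemma swapOff_apply_of_notMem {ζ : Config E} {e : E} (he : x ∉ ends e) :
    swapOff ends x ζ e = blue ζ e := by
  simp only [swapOff, if_neg he, blue_apply]

/-- The swap is an involution. -/
lemma swapOff_swapOff (ζ : Config E) : swapOff ends x (swapOff ends x ζ) = ζ := by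
  funext e
  by_cases he : x ∈ ends e
  · rw [swapOff_apply_of_mem he, swapOff_apply_of_mem he]
  · rw [swapOff_apply_of_notMem he, blue_apply, swapOff_apply_of_notMem he, blue_apply,
      Bool.not_not]

/-- Off the edges at `x`, the swapped configuration is the blue one. -/
lemma swapOff_agree (ζ : Config E) : ∀ e, x ∉ ends e → swapOff ends x ζ e = blue ζ e :=
  fun _ he => swapOff_apply_of_notMem he

/-- Off the edges at `x`, the blue of the swapped configuration is the original. -/
lemma blue_swapOff_agree (ζ : Config E) : ∀ e, x ∉ ends e → blue (swapOff ends x ζ) e = ζ e := by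
  intro e he
  rw [blue_apply, swapOff_apply_of_notMem he, blue_apply, Bool.not_not]

/-- In the isolated graph the clusters of the swapped configuration are the blue clusters. -/
lemma cluster_isolate_swapOff (ζ : Config E) (v : V) :
    cluster (isolate ends x) (swapOff ends x ζ) v = cluster (isolate ends x) (blue ζ) v :=
  cluster_isolate_eq_of_agree (swapOff_agree ζ) v

/-- In the isolated graph the blue clusters of the swapped configuration are the red clusters. -/
lemma cluster_isolate_blue_swapOff (ζ : Config E) (v : V) :
    cluster (isolate ends x) (blue (swapOff ends x ζ)) v = cluster (isolate ends x) ζ v :=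
  cluster_isolate_eq_of_agree (blue_swapOff_agree ζ) v

/-- The swap turns the red edge set of `h` of the isolated graph into the blue one. -/
lemma redEdges_isolate_swapOff {h : V} (hh : h ≠ x) (ζ : Config E) :
    redEdges (isolate ends x) (swapOff ends x ζ) h = blueEdges (isolate ends x) ζ h :=
  redEdges_isolate_eq_of_agree hh (swapOff_agree ζ)

/-- The swap turns the blue edge set of `h` of the isolated graph into the red one. -/
lemma blueEdges_isolate_swapOff {h : V} (hh : h ≠ x) (ζ : Config E) :
    blueEdges (isolate ends x) (swapOff ends x ζ) h = redEdges (isolate ends x) ζ h :=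
  redEdges_isolate_eq_of_agree hh (blue_swapOff_agree ζ)

section PartB

variable [Fintype E] [DecidableEq E]

variable {p h l : V} (hm : IsHMarkAt ends x p h) (hxl : x ≠ l)
include hm hxl

/-- **The swap keeps the part `B` of the side of the H-mark**: for `ζ ∈ Q_x` with `p ∈ C_B(l)` in
the isolated graph, the swapped configuration is in `Q_x` with `p ∈ C_B(l)` again. -/
lemma IsHMarkAt.swapOff_mem {ζ : Config E} (hζ : ζ ∈ tgtU ends l h {S : Set V | x ∈ S})
    (hpB : p ∈ cluster (isolate ends x) (blue ζ) l) :
    swapOff ends x ζ ∈ tgtU ends l h {S : Set V | x ∈ S} ∧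
      p ∈ cluster (isolate ends x) (blue (swapOff ends x ζ)) l := by
  rw [hm.mem_tgt_iff hxl] at hζ ⊢
  obtain ⟨hh, ⟨e, he, hred⟩, hpR, hg, hpB'⟩ := hζ
  have hall : ∀ e', ends e' = s(x, p) → ζ e' = true := hpB' hpB
  rw [cluster_isolate_blue_swapOff, cluster_isolate_swapOff]
  refine ⟨⟨?_, ⟨e, he, ?_⟩, hpB, ?_, fun _ e' he' => ?_⟩, hpR⟩
  · intro h1
    simp only [hull, Set.mem_union, cluster_isolate_swapOff, cluster_isolate_blue_swapOff] at h1
    exact hh (h1.elim Or.inr Or.inl)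
  · rw [swapOff_apply_of_mem (by rw [he]; exact Sym2.mem_mk_left _ _)]
    exact hred
  · intro g hg'
    rw [swapOff_apply_of_mem (by rw [hg']; exact Sym2.mem_mk_left _ _)]
    exact hg g hg'
  · rw [swapOff_apply_of_mem (by rw [he']; exact Sym2.mem_mk_left _ _)]
    exact hall e' he'

end PartB

end LocRows

end Summit.Ventures.PercRepro2
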